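import Literature.Probability.LatticeModels.KilledWalkPotential
import Literature.Probability.LatticeModels.EdgeFirstExit
import Literature.Probability.LatticeModels.EdgeKilledAnnulusManeuver
import HarnessLib

/-!
# Side-potential bookkeeping for the edge-killed walk (line `symplectic-fermion-anchor`,
crux `SAWLoopFugacityFlow.AvoidanceLimit`, stmt-CriticalPhenomena-10649; stubs W19
`killedPotential_sideSrc_univ`, `one_sub_le_sidePotentials`)

Setting of `KilledWalkLaplacian.lean`, `KilledWalkPotential.lean`, `EdgeFirstExit.lean` and
`EdgeKilledAnnulusManeuver.lean`: the simple random walk on `ℤ²` run along the edges of a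
subgraph `Gr` and killed at its first step that is not a `Gr`-edge, stopped on leaving a finite
region `S`; `edgeSurvive Gr S = killedHarmExt Gr S 1` is the probability of leaving `S` alive,
`killedPotential Gr S ψ = ∑_y G_S(·,y) ψ y` the Green potential of a source `ψ`,
`sideSrc Gr Ω δ A y = ¼ · #{e | ¬ Gr.Adj y (y+e), edgeLanding Ω δ y e ∈ A}` the one-step
probability of dying at `y` through an edge landing in `A ⊆ ℂ`, and `hitProb Gr S Y` the
probability of hitting `Y` before leaving `S`.

* `killedPotential_sideSrc_univ` — **the death probability is the potential of the death rate**: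
  on `S`, `killedPotential Gr S (sideSrc Gr Ω δ univ) = 1 - edgeSurvive Gr S`. Indeed
  `F = 1 - edgeSurvive Gr S` vanishes off `S`, and on `S` the constant `1` satisfies
  `killedAvg 1 + sideSrc univ = 1` (`killedAvg_one_add_sideSrc_univ`) while `edgeSurvive` is
  killed-harmonic, so `killedAvg F - F = -sideSrc univ`; uniqueness for the Poisson problem
  (`eq_killedPotential_of_killedAvg_sub_eq`, Lawler–Limic 2010, §6.2).
* `one_sub_le_sidePotentials` — for disjoint `A, B ⊆ ℂ` the death rate splits as
  `sideSrc univ = sideSrc A + sideSrc B + sideSrc (A ∪ B)ᶜ`, hence (additivity of the potential)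
  `1 - edgeSurvive = Φ_A + Φ_B + Φ_R` on `S`. If every site of `S` carrying a fatal edge landing
  outside `A ∪ B` lies in `Y`, the leftover potential `Φ_R` is killed-harmonic on `S ∖ Y` (its
  source vanishes there), `≤ 1` everywhere and `= 0` off `S`, so the comparison principle on the
  finite set `S ∖ Y` against `hitProb Gr S Y` (killed-harmonic on `S ∖ Y`, `= 1` on `Y`, `≥ 0`)
  gives `Φ_R ≤ hitProb Gr S Y`, whence `1 - edgeSurvive - hitProb_Y ≤ Φ_A + Φ_B` on `S`.

Everything is proved from the cited project files (maximum principle only). No definitions.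
Sources: G. F. Lawler, V. Limic, *Random Walk: A Modern Introduction*, CUP (2010), §6.2
(Poisson equation `Δf = -g` on a finite set) [LawlerLimic2010]; D. Chelkak, *Robust discrete
complex analysis: a toolbox*, Ann. Probab. 44 (2016), §2.2–§2.3 (boundary half-edges of a
discrete domain, Green's function) [Chelkak2016].
-/

noncomputable section

open scoped BigOperators Classical
open Set
open Literature.Probability.LatticeModels

namespace Summit.CriticalPhenomena.SAWScalingLimit.Theorems.AvoidanceLimit.Anchor

/-! ### The death probability as the potential of the death rate -/

/-- **Poisson equation for the death probability.** On the finite region `S`, the function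
`F = 1 - edgeSurvive Gr S` satisfies `killedAvg Gr F v - F v = -sideSrc Gr Ω δ univ v`:
`killedAvg F = killedAvg 1 - killedAvg (edgeSurvive) = (1 - sideSrc univ) - edgeSurvive` by
linearity, `killedAvg_one_add_sideSrc_univ` and the killed-harmonicity of `edgeSurvive` on `S`.
[folklore] -/
theorem killedAvg_one_sub_edgeSurvive_sub {Gr : SimpleGraph (Site 2)} (Ω : Set ℂ) (δ : ℝ)
    {S : Set (Site 2)} (hS : S.Finite) {v : Site 2} (hv : v ∈ S) :
    killedAvg Gr (fun w => 1 - edgeSurvive Gr S w) v - (1 - edgeSurvive Gr S v) =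
      -sideSrc Gr Ω δ Set.univ v := by
  have h1 : killedAvg Gr (fun w => 1 - edgeSurvive Gr S w) v =
      killedAvg Gr 1 v - killedAvg Gr (edgeSurvive Gr S) v :=
    killedAvg_sub Gr 1 (edgeSurvive Gr S) v
  have h2 : edgeSurvive Gr S v = killedAvg Gr (edgeSurvive Gr S) v :=
    killedHarmExt_harmonicOn hS _ v hv
  have h3 := killedAvg_one_add_sideSrc_univ Gr (Ω := Ω) (δ := δ) v
  linarith

/-- **The death probability is the Green potential of the one-step death rate** (W19a): for the
edge-killed walk in a finite region `S`, on `S`,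
`killedPotential Gr S (sideSrc Gr Ω δ univ) v = 1 - edgeSurvive Gr S v` — the walk from `v` dies
before leaving `S` exactly when, at some site `y ∈ S` visited before the exit, it takes a
non-`Gr` edge, an event of one-step probability `sideSrc univ y`; analytically,
`1 - edgeSurvive Gr S` vanishes off `S` (`edgeSurvive = 1` there) and solves the Poisson equation
with source `sideSrc univ` on `S` (`killedAvg_one_sub_edgeSurvive_sub`), so it is the potential
of that source by uniqueness for the Poisson problem (Lawler–Limic 2010, §6.2).
[cite: LawlerLimic2010, §6.2] -/
theorem killedPotential_sideSrc_univ :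
    ∀ (Gr : SimpleGraph (Site 2)) (Ω : Set ℂ) (δ : ℝ) (S : Set (Site 2)), S.Finite →
      ∀ v ∈ S, killedPotential Gr S (sideSrc Gr Ω δ Set.univ) v = 1 - edgeSurvive Gr S v := by
  intro Gr Ω δ S hS v _
  exact (eq_killedPotential_of_killedAvg_sub_eq (Gr := Gr) hS
    (F := fun w => 1 - edgeSurvive Gr S w) (ψ := sideSrc Gr Ω δ Set.univ)
    (fun w hw => by simp only [edgeSurvive_of_not_mem hw, sub_self])
    (fun w hw => killedAvg_one_sub_edgeSurvive_sub Ω δ hS hw) v).symm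

/-! ### Splitting the death rate by landing classes -/

/-- A site none of whose lattice edges lies in the landing class of `A` carries no side source
of `A`. [folklore] -/
theorem sideSrc_eq_zero_of_forall_not_landsIn {Gr : SimpleGraph (Site 2)} {Ω : Set ℂ} {δ : ℝ}
    {A : Set ℂ} {y : Site 2} (H : ∀ e : SRW.Dir 2, ¬ landsIn Gr Ω δ A y e) :
    sideSrc Gr Ω δ A y = 0 := by
  have h : (Finset.univ.filter fun e : SRW.Dir 2 => landsIn Gr Ω δ A y e) = ∅ :=
    Finset.filter_eq_empty_iff.2 fun e _ he => H e he
  simp [sideSrc, h]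

/-- **Splitting of the death rate**: for disjoint `A, B ⊆ ℂ`,
`sideSrc univ = sideSrc A + sideSrc B + sideSrc (A ∪ B)ᶜ` (every fatal edge lands in exactly one
of `A`, `B`, `(A ∪ B)ᶜ`). [folklore] -/
theorem sideSrc_univ_eq_add_add {Gr : SimpleGraph (Site 2)} {Ω : Set ℂ} {δ : ℝ} {A B : Set ℂ}
    (hAB : Disjoint A B) :
    sideSrc Gr Ω δ Set.univ = sideSrc Gr Ω δ A + sideSrc Gr Ω δ B + sideSrc Gr Ω δ (A ∪ B)ᶜ := by
  funext y
  have hd : Disjoint (A ∪ B) (A ∪ B)ᶜ := disjoint_compl_right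
  rw [Pi.add_apply, Pi.add_apply, ← sideSrc_union_of_disjoint hAB, ← sideSrc_union_of_disjoint hd,
    Set.union_compl_self]

/-- **Splitting of the death probability**: for disjoint `A, B ⊆ ℂ` and `v` in the finite region
`S`, `1 - edgeSurvive Gr S v = Φ_A v + Φ_B v + Φ_R v` with `Φ_X = killedPotential Gr S (sideSrc X)`
and `R = (A ∪ B)ᶜ` (`killedPotential_sideSrc_univ` and additivity of the potential). [folklore] -/
theorem one_sub_edgeSurvive_eq_potentials {Gr : SimpleGraph (Site 2)} (Ω : Set ℂ) (δ : ℝ)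
    {S : Set (Site 2)} (hS : S.Finite) {A B : Set ℂ} (hAB : Disjoint A B) {v : Site 2}
    (hv : v ∈ S) :
    1 - edgeSurvive Gr S v = killedPotential Gr S (sideSrc Gr Ω δ A) v +
      killedPotential Gr S (sideSrc Gr Ω δ B) v + killedPotential Gr S (sideSrc Gr Ω δ (A ∪ B)ᶜ) v := by
  rw [← killedPotential_sideSrc_univ Gr Ω δ S hS v hv, sideSrc_univ_eq_add_add hAB,
    killedPotential_add, killedPotential_add]

/-- The leftover side potential `Φ_R = killedPotential Gr S (sideSrc (A ∪ B)ᶜ)` is at most `1`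
everywhere: on `S` it is one of three nonnegative terms summing to `1 - edgeSurvive ≤ 1`, and it
vanishes off `S`. [folklore] -/
theorem killedPotential_sideSrc_compl_le_one {Gr : SimpleGraph (Site 2)} (Ω : Set ℂ) (δ : ℝ)
    {S : Set (Site 2)} (hS : S.Finite) {A B : Set ℂ} (hAB : Disjoint A B) (w : Site 2) :
    killedPotential Gr S (sideSrc Gr Ω δ (A ∪ B)ᶜ) w ≤ 1 := by
  by_cases hw : w ∈ S
  · have h := one_sub_edgeSurvive_eq_potentials (Gr := Gr) Ω δ hS hAB hw
    have hA : 0 ≤ killedPotential Gr S (sideSrc Gr Ω δ A) w :=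
      killedPotential_nonneg (fun _ _ => sideSrc_nonneg) w
    have hB : 0 ≤ killedPotential Gr S (sideSrc Gr Ω δ B) w :=
      killedPotential_nonneg (fun _ _ => sideSrc_nonneg) w
    have hE := (edgeSurvive_mem_Icc (Gr := Gr) hS w).1
    linarith
  · rw [killedPotential_of_not_mem _ hw]
    exact zero_le_one

/-- **The leftover side potential is dominated by the hitting probability of the exceptional
set.** If every site of the finite region `S` carrying a fatal edge landing in `(A ∪ B)ᶜ` lies in
`Y`, then `killedPotential Gr S (sideSrc (A ∪ B)ᶜ) ≤ hitProb Gr S Y` everywhere: off `S ∖ Y` the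
right side is the indicator of `Y` and the left side is `≤ 1`, and `= 0` off `S`; on the finite
set `S ∖ Y` the left side is killed-harmonic (its source vanishes there) and the right side is
killed-harmonic, so the comparison principle applies. [folklore] -/
theorem killedPotential_sideSrc_compl_le_hitProb {Gr : SimpleGraph (Site 2)} (Ω : Set ℂ) (δ : ℝ)
    {S : Set (Site 2)} (hS : S.Finite) {A B : Set ℂ} (hAB : Disjoint A B) {Y : Set (Site 2)}
    (hY : ∀ y ∈ S, ∀ e : SRW.Dir 2, landsIn Gr Ω δ (A ∪ B)ᶜ y e → y ∈ Y) (v : Site 2) :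
    killedPotential Gr S (sideSrc Gr Ω δ (A ∪ B)ᶜ) v ≤ hitProb Gr S Y v := by
  -- the inequality off `S ∖ Y`
  have hoff : ∀ w ∉ S \ Y, killedPotential Gr S (sideSrc Gr Ω δ (A ∪ B)ᶜ) w ≤ hitProb Gr S Y w := by
    intro w hw
    rw [hitProb_of_not_mem hw]
    split_ifs with hwY
    · exact killedPotential_sideSrc_compl_le_one Ω δ hS hAB w
    · rw [killedPotential_of_not_mem _ (fun hwS => hw ⟨hwS, hwY⟩)]
  by_cases hv : v ∈ S \ Y
  swap
  · exact hoff v hv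
  -- on `S ∖ Y`: comparison principle for two killed-harmonic functions
  have h1 : IsKilledHarmonicOn Gr (killedPotential Gr S (sideSrc Gr Ω δ (A ∪ B)ᶜ)) (S \ Y) :=
    killedPotential_harmonicOn hS fun w hw =>
      ⟨hw.1, sideSrc_eq_zero_of_forall_not_landsIn fun e he => hw.2 (hY w hw.1 e he)⟩
  exact le_of_killedSub_killedSuper_of_boundary (hS.subset Set.sdiff_subset) h1.subharmonicOn
    (hitProb_harmonicOn hS).superharmonicOn (fun w hw => hoff w hw.1) v hv

/-- **Side-potential bookkeeping** (W19b): for the edge-killed walk in a finite region `S`,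
disjoint `A, B ⊆ ℂ` and a set `Y` of sites containing every site of `S` with a fatal edge landing
outside `A ∪ B`, on `S`,
`1 - edgeSurvive Gr S v - hitProb Gr S Y v ≤ Φ_A v + Φ_B v` with
`Φ_X = killedPotential Gr S (sideSrc Gr Ω δ X)`: the probability of dying before leaving `S`
splits according to where the fatal edge lands, `1 - edgeSurvive = Φ_A + Φ_B + Φ_{(A ∪ B)ᶜ}`
(`one_sub_edgeSurvive_eq_potentials`), and dying through an edge landing outside `A ∪ B`
requires first reaching `Y`, `Φ_{(A ∪ B)ᶜ} ≤ hitProb Gr S Y`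
(`killedPotential_sideSrc_compl_le_hitProb`). [cite: LawlerLimic2010, §6.2] -/
theorem one_sub_le_sidePotentials :
    ∀ (Gr : SimpleGraph (Site 2)) (Ω : Set ℂ) (δ : ℝ) (S : Set (Site 2)), S.Finite →
      ∀ (A B : Set ℂ), Disjoint A B → ∀ (Y : Set (Site 2)),
      (∀ y ∈ S, ∀ e : SRW.Dir 2, landsIn Gr Ω δ (A ∪ B)ᶜ y e → y ∈ Y) →
      ∀ v ∈ S, 1 - edgeSurvive Gr S v - hitProb Gr S Y v ≤
        killedPotential Gr S (sideSrc Gr Ω δ A) v + killedPotential Gr S (sideSrc Gr Ω δ B) v := by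
  intro Gr Ω δ S hS A B hAB Y hY v hv
  have h1 := one_sub_edgeSurvive_eq_potentials (Gr := Gr) Ω δ hS hAB hv
  have h2 := killedPotential_sideSrc_compl_le_hitProb (Gr := Gr) Ω δ hS hAB hY v
  linarith

end Summit.CriticalPhenomena.SAWScalingLimit.Theorems.AvoidanceLimit.Anchor

end
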